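import Mathlib
import Summits.Ventures.HodgeRepro.Tier4.Line1.RTFSetting
import Summits.Ventures.HodgeRepro.Tier4.Line4.ProjectedTestList

/-!
# Tier4/Line4/ProjectorSupport — C-L4-PROJSUPP (1): the support of the projectors on a general group

Blind re-derivation cell `pub-hodge-repro`, Tier 4 «PROVE THE STEP» (README §9–§10), LINE L4, seat t4-L2-p1 g2 on
t4-plan-4 g3's cut C-L4-PROJSUPP (S14260, census §11), part (1) — the general-group half; the adelic half (2)–(5) is
`Tier4/Line4/ProjectedSupport.lean`.

* `tsupport_kProj_subset` / `tsupport_kProjL_subset` / `tsupport_biProj_subset`: the right / left / bi-projector of a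
  compactly supported function moves its support by the compact subgroup `C` on the right / left / both sides (closure
  by compactness in a `T2` group; `kProjL = refl ∘ kProj ∘ refl`, `tsupport_refl_subset`).
* `ProjDatum.prodSet` / `prodSetRev` — the ordered / reversed products `C₁ ⋯ Cₙ` of the subgroups of a list of projection
  data (`[] ↦ 1 = {1}`), with `prodSet_append`, `prodSetRev_append`, compactness, `prodSet_mul_comm` (a datum commuting
  with every datum of the list commutes with its product), `prodSetRev_eq_prodSet_of_pairwise`,
  `prodSet_mul_prodSet_subset`, `prodSet_subset`.
* **`tsupport_biProjList_subset`**: `tsupport (biProjList l f) ⊆ prodSet l · tsupport f · prodSetRev l` (every datum good,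
  `f` compactly supported).
* `tsupport_conv_subset`: the convolution of two compactly supported functions is supported in the product of the
  supports (re-proved here; the PairOrbital copy is not of record).

Nothing here says anything about the status of the Hodge conjecture for CM abelian varieties, which is NOT proved
(HC_CM is NOT proved by anyone in this repository).
-/

set_option autoImplicit false

noncomputable section

namespace Summit.Ventures.HodgeRepro.Tier4.Line4

open Summit.Ventures.HodgeRepro.Tier4.Common Summit.Ventures.HodgeRepro.Tier4.Line1 MeasureTheory
open scoped ComplexConjugate Pointwise

/-! ### (1) The support of the projectors on a general group -/

section SetLemmas

variable {G : Type} [Group G]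

/-- The inverse of (the carrier of) a subgroup is itself. -/
theorem inv_coe_subgroup (C : Subgroup G) : (C : Set G)⁻¹ = C := by
  ext x
  simp

/-- Two sets whose elements commute pairwise have the same product in either order. -/
theorem Set.mul_comm_of_forall {s t : Set G} (h : ∀ a ∈ s, ∀ b ∈ t, a * b = b * a) : s * t = t * s := by
  ext x
  constructor
  · rintro ⟨a, ha, b, hb, rfl⟩
    exact ⟨b, hb, a, ha, (h a ha b hb).symm⟩
  · rintro ⟨b, hb, a, ha, rfl⟩
    exact ⟨a, ha, b, hb, h a ha b hb⟩

/-- The carrier of a subgroup absorbs its own products. -/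
theorem coe_mul_coe_subset (C : Subgroup G) : (C : Set G) * C ⊆ C :=
  Set.mul_subset_iff.2 fun _ ha _ hb => C.mul_mem ha hb

end SetLemmas

section Supports

variable {G : Type} [Group G] [TopologicalSpace G] [IsTopologicalGroup G] [MeasurableSpace G] [BorelSpace G]

omit [BorelSpace G] in
/-- **The right projector moves the support by `C` on the right**: `tsupport (e_{C,χ} ψ) ⊆ tsupport ψ · C`
(compact `C`, compactly supported `ψ`, `T2` group). -/
theorem tsupport_kProj_subset [T2Space G] (C : Subgroup G) (ν : Measure C) (hC : IsCompact (C : Set G)) {χ ψ : G → ℂ}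
    (hψ : HasCompactSupport ψ) : tsupport (kProj C ν χ ψ) ⊆ tsupport ψ * (C : Set G) := by
  refine closure_minimal ?_ (hψ.mul hC).isClosed
  intro x hx
  by_contra hnot
  apply hx
  have hz : ∀ κ : C, ψ (x * κ) = 0 := fun κ =>
    image_eq_zero_of_notMem_tsupport
      (mul_notMem_tsupport_of_notMem C (by rwa [inv_coe_subgroup]) κ.2)
  simp [kProj, hz]

omit [MeasurableSpace G] [BorelSpace G] in
/-- The reflection `ψˇ(x) = ψ(x⁻¹)` has support inside the inverse of the support. -/
theorem tsupport_refl_subset (ψ : G → ℂ) : tsupport (RTF.refl ψ) ⊆ (tsupport ψ)⁻¹ := by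
  refine closure_minimal ?_ (isClosed_tsupport ψ).inv
  intro x hx
  rw [Set.mem_inv]
  exact subset_tsupport ψ hx

omit [MeasurableSpace G] [BorelSpace G] in
/-- The reflection of a compactly supported function is compactly supported. -/
theorem hasCompactSupport_refl {ψ : G → ℂ} (hψ : HasCompactSupport ψ) : HasCompactSupport (RTF.refl ψ) :=
  IsCompact.of_isClosed_subset hψ.inv (isClosed_tsupport _) (tsupport_refl_subset ψ)

omit [BorelSpace G] in
/-- **The left projector moves the support by `C` on the left**: `tsupport (e^L_{C,χ} ψ) ⊆ C · tsupport ψ`. -/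
theorem tsupport_kProjL_subset [T2Space G] (C : Subgroup G) (ν : Measure C) (hC : IsCompact (C : Set G))
    {χ ψ : G → ℂ} (hψ : HasCompactSupport ψ) : tsupport (kProjL C ν χ ψ) ⊆ (C : Set G) * tsupport ψ := by
  unfold kProjL
  calc tsupport (RTF.refl (kProj C ν χ (RTF.refl ψ)))
      ⊆ (tsupport (kProj C ν χ (RTF.refl ψ)))⁻¹ := tsupport_refl_subset _
    _ ⊆ (tsupport (RTF.refl ψ) * (C : Set G))⁻¹ :=
        Set.inv_subset_inv.2 (tsupport_kProj_subset C ν hC (hasCompactSupport_refl hψ))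
    _ = ((C : Set G))⁻¹ * (tsupport (RTF.refl ψ))⁻¹ := mul_inv_rev _ _
    _ ⊆ (C : Set G) * tsupport ψ := by
        rw [inv_coe_subgroup]
        refine Set.mul_subset_mul_left ?_
        have := Set.inv_subset_inv.2 (tsupport_refl_subset ψ)
        rwa [inv_inv] at this

omit [BorelSpace G] in
/-- **The bi-projector moves the support by `C` on both sides**: `tsupport (biProj C ν χ f) ⊆ C · tsupport f · C`. -/
theorem tsupport_biProj_subset [T2Space G] (C : Subgroup G) (ν : Measure C) (hC : IsCompact (C : Set G))
    {χ f : G → ℂ} (hf : HasCompactSupport f) :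
    tsupport (biProj C ν χ f) ⊆ (C : Set G) * tsupport f * (C : Set G) := by
  have h1 : tsupport (kProj C ν (fun g => conj (χ g)) f) ⊆ tsupport f * (C : Set G) :=
    tsupport_kProj_subset C ν hC hf
  have h1c : HasCompactSupport (kProj C ν (fun g => conj (χ g)) f) :=
    IsCompact.of_isClosed_subset (hf.mul hC) (isClosed_tsupport _) h1
  unfold biProj
  calc tsupport (kProjL C ν χ (kProj C ν (fun g => conj (χ g)) f))
      ⊆ (C : Set G) * tsupport (kProj C ν (fun g => conj (χ g)) f) := tsupport_kProjL_subset C ν hC h1c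
    _ ⊆ (C : Set G) * (tsupport f * (C : Set G)) := Set.mul_subset_mul_left h1
    _ = (C : Set G) * tsupport f * (C : Set G) := (mul_assoc _ _ _).symm

/-- The ordered product `C₁ · C₂ ⋯ Cₙ` of the subgroups of a list of projection data (`[] ↦ 1 = {1}`). -/
def ProjDatum.prodSet : List (ProjDatum G) → Set G
  | [] => 1
  | d :: l => (d.C : Set G) * ProjDatum.prodSet l

/-- The reversed product `Cₙ ⋯ C₂ · C₁`. -/
def ProjDatum.prodSetRev : List (ProjDatum G) → Set G
  | [] => 1
  | d :: l => ProjDatum.prodSetRev l * (d.C : Set G)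

omit [IsTopologicalGroup G] [BorelSpace G] in
/-- The product over the empty list is `1`. -/
theorem ProjDatum.prodSet_nil : ProjDatum.prodSet ([] : List (ProjDatum G)) = 1 := rfl

omit [IsTopologicalGroup G] [BorelSpace G] in
/-- The product over `d :: l` is `C_d · prodSet l`. -/
theorem ProjDatum.prodSet_cons (d : ProjDatum G) (l : List (ProjDatum G)) :
    ProjDatum.prodSet (d :: l) = (d.C : Set G) * ProjDatum.prodSet l := rfl

omit [IsTopologicalGroup G] [BorelSpace G] in
/-- The reversed product over the empty list is `1`. -/
theorem ProjDatum.prodSetRev_nil : ProjDatum.prodSetRev ([] : List (ProjDatum G)) = 1 := rfl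

omit [IsTopologicalGroup G] [BorelSpace G] in
/-- The reversed product over `d :: l` is `prodSetRev l · C_d`. -/
theorem ProjDatum.prodSetRev_cons (d : ProjDatum G) (l : List (ProjDatum G)) :
    ProjDatum.prodSetRev (d :: l) = ProjDatum.prodSetRev l * (d.C : Set G) := rfl

omit [IsTopologicalGroup G] [BorelSpace G] in
/-- The product over an appended list. -/
theorem ProjDatum.prodSet_append (l₁ l₂ : List (ProjDatum G)) :
    ProjDatum.prodSet (l₁ ++ l₂) = ProjDatum.prodSet l₁ * ProjDatum.prodSet l₂ := by
  induction l₁ with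
  | nil => rw [List.nil_append, ProjDatum.prodSet_nil, one_mul]
  | cons d l ih => rw [List.cons_append, ProjDatum.prodSet_cons, ih, ProjDatum.prodSet_cons, mul_assoc]

omit [IsTopologicalGroup G] [BorelSpace G] in
/-- The reversed product over an appended list. -/
theorem ProjDatum.prodSetRev_append (l₁ l₂ : List (ProjDatum G)) :
    ProjDatum.prodSetRev (l₁ ++ l₂) = ProjDatum.prodSetRev l₂ * ProjDatum.prodSetRev l₁ := by
  induction l₁ with
  | nil => rw [List.nil_append, ProjDatum.prodSetRev_nil, mul_one]
  | cons d l ih => rw [List.cons_append, ProjDatum.prodSetRev_cons, ih, ProjDatum.prodSetRev_cons, mul_assoc]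

omit [BorelSpace G] in
/-- The product of compact subgroups is compact. -/
theorem ProjDatum.isCompact_prodSet (l : List (ProjDatum G)) (hl : ∀ d ∈ l, IsCompact (d.C : Set G)) :
    IsCompact (ProjDatum.prodSet l) := by
  induction l with
  | nil => exact isCompact_singleton
  | cons d l ih =>
    exact (hl d (List.mem_cons_self ..)).mul (ih fun d' hd' => hl d' (List.mem_cons_of_mem _ hd'))

omit [BorelSpace G] in
/-- The reversed product of compact subgroups is compact. -/
theorem ProjDatum.isCompact_prodSetRev (l : List (ProjDatum G)) (hl : ∀ d ∈ l, IsCompact (d.C : Set G)) :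
    IsCompact (ProjDatum.prodSetRev l) := by
  induction l with
  | nil => exact isCompact_singleton
  | cons d l ih =>
    exact (ih fun d' hd' => hl d' (List.mem_cons_of_mem _ hd')).mul (hl d (List.mem_cons_self ..))

omit [IsTopologicalGroup G] [BorelSpace G] in
/-- A datum commuting with every datum of a list commutes with the list's product. -/
theorem ProjDatum.prodSet_mul_comm (d : ProjDatum G) (l : List (ProjDatum G)) (h : ∀ d' ∈ l, d.Commutes d') :
    ProjDatum.prodSet l * (d.C : Set G) = (d.C : Set G) * ProjDatum.prodSet l := by
  induction l with
  | nil => rw [ProjDatum.prodSet_nil, one_mul, mul_one]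
  | cons d' l ih =>
    rw [ProjDatum.prodSet_cons, mul_assoc, ih fun d'' hd'' => h d'' (List.mem_cons_of_mem _ hd''), ← mul_assoc,
      Set.mul_comm_of_forall fun a ha b hb => (h d' (List.mem_cons_self ..) b hb a ha).symm, mul_assoc]

omit [IsTopologicalGroup G] [BorelSpace G] in
/-- For pairwise commuting data the reversed product is the product. -/
theorem ProjDatum.prodSetRev_eq_prodSet_of_pairwise (l : List (ProjDatum G)) (hl : l.Pairwise ProjDatum.Commutes) :
    ProjDatum.prodSetRev l = ProjDatum.prodSet l := by
  induction l with
  | nil => rfl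
  | cons d l ih =>
    rw [ProjDatum.prodSetRev_cons, ih (List.pairwise_cons.1 hl).2, ProjDatum.prodSet_mul_comm d l
      (List.pairwise_cons.1 hl).1, ProjDatum.prodSet_cons]

omit [IsTopologicalGroup G] [BorelSpace G] in
/-- The product of pairwise commuting subgroups absorbs its own products. -/
theorem ProjDatum.prodSet_mul_prodSet_subset (l : List (ProjDatum G)) (hl : l.Pairwise ProjDatum.Commutes) :
    ProjDatum.prodSet l * ProjDatum.prodSet l ⊆ ProjDatum.prodSet l := by
  induction l with
  | nil => rw [ProjDatum.prodSet_nil, one_mul]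
  | cons d l ih =>
    have hcomm := ProjDatum.prodSet_mul_comm d l (List.pairwise_cons.1 hl).1
    rw [ProjDatum.prodSet_cons]
    calc (d.C : Set G) * ProjDatum.prodSet l * ((d.C : Set G) * ProjDatum.prodSet l)
        = (d.C : Set G) * (ProjDatum.prodSet l * (d.C : Set G)) * ProjDatum.prodSet l := by
          simp only [mul_assoc]
      _ = (d.C : Set G) * ((d.C : Set G) * ProjDatum.prodSet l) * ProjDatum.prodSet l := by rw [hcomm]
      _ = ((d.C : Set G) * (d.C : Set G)) * (ProjDatum.prodSet l * ProjDatum.prodSet l) := by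
          simp only [mul_assoc]
      _ ⊆ (d.C : Set G) * ProjDatum.prodSet l :=
          Set.mul_subset_mul (coe_mul_coe_subset d.C) (ih (List.pairwise_cons.1 hl).2)

omit [IsTopologicalGroup G] [BorelSpace G] in
/-- The product of subgroups of `H` lies in `H`. -/
theorem ProjDatum.prodSet_subset (l : List (ProjDatum G)) (H : Subgroup G) (hl : ∀ d ∈ l, (d.C : Set G) ⊆ H) :
    ProjDatum.prodSet l ⊆ H := by
  induction l with
  | nil =>
    rw [ProjDatum.prodSet_nil]
    rintro x hx
    rw [Set.mem_one] at hx
    rw [hx]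
    exact H.one_mem
  | cons d l ih =>
    rw [ProjDatum.prodSet_cons]
    exact (Set.mul_subset_mul (hl d (List.mem_cons_self ..)) (ih fun d' hd' => hl d' (List.mem_cons_of_mem _ hd'))).trans
      (coe_mul_coe_subset H)

omit [BorelSpace G] in
/-- **(1) The support of the composite bi-projector**: `tsupport (biProjList l f) ⊆ prodSet l · tsupport f · prodSetRev l`
(every datum good, `f` compactly supported). -/
theorem tsupport_biProjList_subset [T2Space G] (l : List (ProjDatum G)) (hl : ∀ d ∈ l, d.Good) {f : G → ℂ}
    (hf : HasCompactSupport f) :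
    tsupport (biProjList l f) ⊆ ProjDatum.prodSet l * tsupport f * ProjDatum.prodSetRev l := by
  induction l with
  | nil =>
    show tsupport f ⊆ (1 : Set G) * tsupport f * (1 : Set G)
    rw [one_mul, mul_one]
  | cons d l ih =>
    have hl' : ∀ d' ∈ l, d'.Good := fun d' hd' => hl d' (List.mem_cons_of_mem _ hd')
    have hd : d.Good := hl d (List.mem_cons_self ..)
    have ih' := ih hl'
    have hcomp : HasCompactSupport (biProjList l f) :=
      IsCompact.of_isClosed_subset
        (((ProjDatum.isCompact_prodSet l fun d' hd' => (hl' d' hd').compact).mul hf).mul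
          (ProjDatum.isCompact_prodSetRev l fun d' hd' => (hl' d' hd').compact))
        (isClosed_tsupport _) ih'
    show tsupport (biProj d.C d.ν d.χ (biProjList l f)) ⊆ _
    calc tsupport (biProj d.C d.ν d.χ (biProjList l f))
        ⊆ (d.C : Set G) * tsupport (biProjList l f) * (d.C : Set G) := tsupport_biProj_subset d.C d.ν hd.compact hcomp
      _ ⊆ (d.C : Set G) * (ProjDatum.prodSet l * tsupport f * ProjDatum.prodSetRev l) * (d.C : Set G) :=
          Set.mul_subset_mul_right (Set.mul_subset_mul_left ih')
      _ = ProjDatum.prodSet (d :: l) * tsupport f * ProjDatum.prodSetRev (d :: l) := by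
          rw [ProjDatum.prodSet_cons, ProjDatum.prodSetRev_cons]
          simp only [mul_assoc]

omit [BorelSpace G] in
/-- The convolution `(f₁ ⋆ f₂)(g) = ∫ f₁(h) f₂(h⁻¹ g)` of two compactly supported functions vanishes off
`tsupport f₁ · tsupport f₂`. -/
theorem tsupport_conv_subset [T2Space G] (S : RTF.Setting G) {f₁ f₂ : G → ℂ} (h₁ : HasCompactSupport f₁)
    (h₂ : HasCompactSupport f₂) : tsupport (S.conv f₁ f₂) ⊆ tsupport f₁ * tsupport f₂ := by
  refine closure_minimal ?_ (h₁.mul h₂).isClosed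
  intro g hg
  by_contra hnot
  apply hg
  have hz : ∀ h : G, f₁ h * f₂ (h⁻¹ * g) = 0 := by
    intro h
    by_contra hne
    apply hnot
    have hh : h ∈ tsupport f₁ := subset_tsupport _ (left_ne_zero_of_mul hne)
    have hh' : h⁻¹ * g ∈ tsupport f₂ := subset_tsupport _ (right_ne_zero_of_mul hne)
    exact ⟨h, hh, h⁻¹ * g, hh', by group⟩
  simp [RTF.Setting.conv, hz]

end Supports


end Summit.Ventures.HodgeRepro.Tier4.Line4

end
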